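import Summits.Ventures.CertifiedArithmetic.LowPrec.SRTwoSumUnbiased
import HarnessLib

/-!
# 2Sum under stochastic rounding on the FP4 table: all pairs, by the kernel (file XXXIX)

HONEST FRAMING: certified error envelopes and provably optimal rounding/accumulation schemes for
low-precision formats under stated cost models; every table by two implementations; no hardware or
vendor claims.

Second implementation, inside the kernel, of the headline of files XXXVII–XXXVIII on the
smallest named format: for ALL `225` ordered pairs of the literal OCP FP4 (E2M1) value table, the
six nested saturating SR steps of 2Sum are evaluated exactly (`decide +kernel`, in five chunks of
the table to stay inside the kernel's memory) and `twoSumE_add_e2m1`: `E[s + t] = a + b` on every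
pair (agrees with the structural theorem `twoSumE_add`).  The companion file `SRTwoSumE2M1Exact`
shows that on FP4 the transformation is moreover exact SURELY.

The cell's two independent Python implementations (`certs/sr/gen7/eft/TS_e2m1_{A,B}`) print the
same table; this file is the third, kernel-checked one.
-/

namespace Summit.Ventures.CertifiedArithmetic.LowPrec.SR

open Literature.ComputerArithmetic.ConnollyHighamMary2021
open Literature.ComputerArithmetic.FloatingPoint
open Finset

/-- The FP4 table in five literal chunks (the kernel evaluates the all-pairs checks below chunk by
chunk: one `decide` over all `225` pairs of six nested SR steps exceeds its memory). -/
theorem e2m1_split5 : FP4.e2m1 = ({-6, -4, -3, -2} : Finset ℚ) ∪ {-3 / 2, -1, -1 / 2} ∪ {0} ∪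
    {1 / 2, 1, 3 / 2, 2} ∪ {3, 4, 6} := by
  decide +kernel

/-- Chunk `a ∈ {-6, -4, -3, -2}` of the FP4 all-pairs check: `E[s + t] = a + b` (kernel). -/
theorem twoSumE_add_e2m1_negA : ∀ a ∈ ({-6, -4, -3, -2} : Finset ℚ), ∀ b ∈ FP4.e2m1,
    twoSumE FP4.e2m1 a b (fun s t => s + t) = a + b := by
  decide +kernel

/-- Chunk `a ∈ {-3/2, -1, -1/2}` of the FP4 all-pairs check: `E[s + t] = a + b` (kernel). -/
theorem twoSumE_add_e2m1_negB : ∀ a ∈ ({-3 / 2, -1, -1 / 2} : Finset ℚ), ∀ b ∈ FP4.e2m1,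
    twoSumE FP4.e2m1 a b (fun s t => s + t) = a + b := by
  decide +kernel

/-- Chunk `a ∈ {1/2, 1, 3/2, 2}` of the FP4 all-pairs check: `E[s + t] = a + b` (kernel). -/
theorem twoSumE_add_e2m1_posA : ∀ a ∈ ({1 / 2, 1, 3 / 2, 2} : Finset ℚ), ∀ b ∈ FP4.e2m1,
    twoSumE FP4.e2m1 a b (fun s t => s + t) = a + b := by
  decide +kernel

/-- Chunk `a ∈ {3, 4, 6}` of the FP4 all-pairs check: `E[s + t] = a + b` (kernel). -/
theorem twoSumE_add_e2m1_posB : ∀ a ∈ ({3, 4, 6} : Finset ℚ), ∀ b ∈ FP4.e2m1,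
    twoSumE FP4.e2m1 a b (fun s t => s + t) = a + b := by
  decide +kernel

/-- Chunk `a = 0` of the FP4 all-pairs check: `E[s + t] = a + b` (kernel). -/
theorem twoSumE_add_e2m1_zero : ∀ b ∈ FP4.e2m1,
    twoSumE FP4.e2m1 0 b (fun s t => s + t) = 0 + b := by
  decide +kernel

/-- **E2M1, second implementation by the kernel**: `E[s + t] = a + b` on all `225` ordered pairs of
the FP4 table (six nested SR steps evaluated exactly, chunk by chunk) — agrees with `twoSumE_add`.
-/
theorem twoSumE_add_e2m1 : ∀ a ∈ FP4.e2m1, ∀ b ∈ FP4.e2m1,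
    twoSumE FP4.e2m1 a b (fun s t => s + t) = a + b := by
  intro a ha
  simp only [e2m1_split5, Finset.mem_union, Finset.mem_singleton] at ha
  rcases ha with (((h | h) | rfl) | h) | h
  · exact twoSumE_add_e2m1_negA a h
  · exact twoSumE_add_e2m1_negB a h
  · exact twoSumE_add_e2m1_zero
  · exact twoSumE_add_e2m1_posA a h
  · exact twoSumE_add_e2m1_posB a h

end Summit.Ventures.CertifiedArithmetic.LowPrec.SR
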